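import Mathlib.NumberTheory.Padics.PadicIntegers
import Mathlib.RingTheory.AdicCompletion.Algebra
import Mathlib.Data.Nat.Factorization.Basic
import Literature.AlgebraicGeometry.Resolution.AdicQuotient
import HarnessLib

/-!
# `p`-adic evaluation of series of logarithmic type `Σ_{m≥1} (b_m/m)·yᵐ` at `p`-nilpotent elements of a ring

Topic `Literature/RingTheory/FormalGroups`; namespace `Literature.RingTheory.FormalGroups.PadicLogSeries`. THE SETTING
(generic, Mathlib only): a prime `p`, a commutative ring `B` with a structure map `ι : ℤ_p → B`, numerators
`b : ℕ → ℤ_p` (the shape of every one-dimensional formal-group logarithm over `ℤ_(p)`: `log_G(X) = Σ (b_m/m) Xᵐ` with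
`b_{m} =` the `(m−1)`-st coefficient of the invariant differential), and a `p`-NILPOTENT element `y ∈ B` witnessed by
`z ∈ B` with `y^N = p·z` (`N ≥ 1`). Then `p^N · (b_m/m) · yᵐ` makes sense INSIDE `B` (no division): writing
`m = Nq + r` one has `p^N yᵐ/m = d_{N,m} · z^q · y^r` with `d_{N,m} = p^{N+q}/m ∈ ℤ_p` — solvable because
**`v_p(m) < N + m/N`** (§1) — and `d_{N,m} ∈ pⁿℤ_p` as soon as `q ≥ 2n`, so the partial sums converge `p`-adically:

* §1 `factorization_add_lt_add_div` (`v_p(m) + n < N + m/N` for `2n ≤ m/N`), `coeffD N m = d_{N,m}` with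
  `m · d_{N,m} = p^{N + m/N}` (`natCast_mul_coeffD`) and its decay (`exists_coeffD_eq_pow_mul`);
* §2 `term ι b N y z m = ι(b_m d_{N,m}) z^{m/N} y^{m%N}` with ★ `m · term = ι(b_m) · p^N · yᵐ` (`natCast_mul_term`, under
  `y^N = p z`), decay `term ∈ pⁿB` for `m/N ≥ 2n`, partial sums `partialSum`, tail estimate `partialSum_sub_partialSum_mem`;
* §3 ★ `logSum ι b N y z ∈ B^_(p)` — the class in the `p`-adic completion (Mathlib `AdicCompletion (p) B`) of the Cauchy
  sequence `n ↦ partialSum (2nN)`, `evalₐ_logSum_of_le` (any truncation point `M ≥ 2nN` represents it mod `pⁿ`);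
* §4 linearity in `b` (`logSum_add`, `logSum_mul_left`) and NATURALITY along ring maps `g : B → B'`
  (`adicCompletionMap g (logSum ι b N y z) = logSum (g∘ι) b N (g y) (g z)`, tree `adicCompletionMap`) — in particular
  every ring endomorphism of `B` fixing `ι(ℤ_p)` (a Frobenius) acts on `logSum` through its arguments;
* §5 independence of the witness `z` and of the exponent `N` (`logSum` scales by `p^{N'−N}`) when `B` is a domain of
  characteristic zero.

Purpose: this is the `p`-adic evaluation layer of Colmez's / Fontaine's periods `log_G(x)`, `x ∈ 𝔸_inf` a lift of a
topologically nilpotent element, with values in the INTEGRAL ring `A_max = 𝔸_inf⟨ξ/p⟩` (tree `PAdicHodge.BmaxPlus`, where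
`y ∈ (p, ξ)𝔸_inf` has `y^N ∈ p·B⁰_max`), on which Frobenius acts — the φ-road to the `X₂`-membership (K₂) of line
`kato_lever` (crux K★ `stmt-BirchSwinnertonDyer-22226`, memo `Lines/kato-lever-K2-phi-road.md`). The `B_dR⁺/Fil^k` twin (no
Frobenius) is `PAdicHodge/BdRPlusLogTypeSeries`. Infrastructure only: BSD / K★ are not proved by any of this.

## References
* P. Colmez, *Périodes p-adiques des variétés abéliennes*, Math. Ann. 292 (1992), §2 (convergence of `log_G` at
  lifts of topologically nilpotent points in Fontaine's rings). [Colmez1992PeriodesAbeliennes]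
* L. Berger, *Représentations p-adiques et équations différentielles*, Invent. Math. 148 (2002), §1.2 (`A_max`,
  `log` converges `p`-adically). [BergerLaurent2002]
* M. Hazewinkel, *Formal Groups and Applications* (1978), Ch. I §2.1–2.3 (logarithms `Σ (b_m/m)Xᵐ`, functional equation
  lemma). [Hazewinkel1978]
-/

noncomputable section

open Finset

namespace Literature.RingTheory.FormalGroups

namespace PadicLogSeries

variable {p : ℕ} [hp : Fact p.Prime]

/-! ## §1 `p`-adic bookkeeping: `v_p(m) < N + m/N` and the coefficients `d_{N,m} = p^{N + m/N}/m ∈ ℤ_p` -/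

/-- `p ∤ n ⇒ n ∈ ℤ_p^×`. [folklore] -/
private theorem isUnit_natCast_of_not_dvd {n : ℕ} (h : ¬ p ∣ n) : IsUnit (n : ℤ_[p]) :=
  PadicInt.isUnit_iff.2 (PadicInt.norm_natCast_eq_one_iff.2 ((Nat.Prime.coprime_iff_not_dvd hp.out).2 h))

/-- `k · d = p^e` is solvable in `ℤ_p` whenever `v_p(k) ≤ e` (`k = p^v·m`, `m ∈ ℤ_p^×`). [folklore] -/
private theorem exists_natCast_mul_eq_pow {k e : ℕ} (hk : k ≠ 0) (he : k.factorization p ≤ e) :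
    ∃ d : ℤ_[p], (k : ℤ_[p]) * d = (p : ℤ_[p]) ^ e := by
  obtain ⟨u, hu⟩ := isUnit_natCast_of_not_dvd (p := p) (Nat.not_dvd_ordCompl hp.out hk)
  have hkm : p ^ k.factorization p * (k / p ^ k.factorization p) = k := Nat.ordProj_mul_ordCompl_eq_self k p
  refine ⟨(p : ℤ_[p]) ^ (e - k.factorization p) * ((u⁻¹ : ℤ_[p]ˣ) : ℤ_[p]), ?_⟩
  calc (k : ℤ_[p]) * ((p : ℤ_[p]) ^ (e - k.factorization p) * ((u⁻¹ : ℤ_[p]ˣ) : ℤ_[p]))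
      = ((p ^ k.factorization p * (k / p ^ k.factorization p) : ℕ) : ℤ_[p]) *
          ((p : ℤ_[p]) ^ (e - k.factorization p) * ((u⁻¹ : ℤ_[p]ˣ) : ℤ_[p])) := by rw [hkm]
    _ = (p : ℤ_[p]) ^ k.factorization p * (p : ℤ_[p]) ^ (e - k.factorization p) *
          ((u : ℤ_[p]) * ((u⁻¹ : ℤ_[p]ˣ) : ℤ_[p])) := by rw [hu]; push_cast; ring
    _ = (p : ℤ_[p]) ^ e := by rw [← pow_add, Nat.add_sub_cancel' he, Units.mul_inv, mul_one]

/-- `2s + 1 ≤ 2^{s+1}`. [folklore] -/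
private theorem two_mul_add_one_le_two_pow_succ (s : ℕ) : 2 * s + 1 ≤ 2 ^ (s + 1) := by
  induction s with
  | zero => simp
  | succ s ih => rw [pow_succ]; omega

/-- **The `p`-adic room: `v_p(m) + n < N + m/N` whenever `2n ≤ m/N`** (`N ≥ 1`, `m ≥ 1`). With `q = m/N`:
`p^{v} ≤ m < N(q+1) ≤ 2^{N−1}·2^{q−n+1} = 2^{N+q−n} ≤ p^{N+q−n}`. The case `n = 0` — `v_p(m) < N + m/N` — is what
makes `p^N·yᵐ/m` integral at a `p`-nilpotent `y` of index `N`; the general case is the `p`-adic decay of these terms.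
[cite: Colmez1992PeriodesAbeliennes, §2] -/
theorem factorization_add_lt_add_div {N m n : ℕ} (hN : 1 ≤ N) (hm : m ≠ 0) (hn : 2 * n ≤ m / N) :
    m.factorization p + n < N + m / N := by
  set v := m.factorization p with hv
  set q := m / N with hq
  have h1 : p ^ v ≤ m := Nat.ordProj_le p hm
  have h2 : m < N * (q + 1) := by
    rw [hq]; exact Nat.lt_mul_div_succ m hN
  have h3 : 2 ^ v ≤ p ^ v := Nat.pow_le_pow_left hp.out.two_le v
  have hN' : N ≤ 2 ^ (N - 1) := by
    have h := @Nat.lt_two_pow_self (N - 1)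
    omega
  have hq' : q + 1 ≤ 2 ^ (q - n + 1) := by
    have h := two_mul_add_one_le_two_pow_succ (q - n)
    have : q + 1 ≤ 2 * (q - n) + 1 := by omega
    exact this.trans h
  have h4 : N * (q + 1) ≤ 2 ^ (N + q - n) := by
    calc N * (q + 1) ≤ 2 ^ (N - 1) * 2 ^ (q - n + 1) := Nat.mul_le_mul hN' hq'
      _ = 2 ^ (N + q - n) := by rw [← pow_add]; congr 1; omega
  have h5 : 2 ^ v < 2 ^ (N + q - n) := lt_of_le_of_lt h3 (lt_of_le_of_lt h1 (lt_of_lt_of_le h2 h4))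
  have h6 : v < N + q - n := (Nat.pow_lt_pow_iff_right (by norm_num : 1 < 2)).1 h5
  omega

/-- `v_p(m) < N + m/N` (`N ≥ 1`, `m ≥ 1`). [cite: Colmez1992PeriodesAbeliennes, §2] -/
theorem factorization_lt_add_div {N m : ℕ} (hN : 1 ≤ N) (hm : m ≠ 0) : m.factorization p < N + m / N := by
  simpa using factorization_add_lt_add_div (p := p) (n := 0) hN hm (Nat.zero_le _)

variable (p) in
/-- **`d_{N,m} = p^{N + m/N}/m ∈ ℤ_p`** (`N, m ≥ 1`; junk `0` otherwise): the `p`-adic coefficient of the `m`-th term of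
`p^N · Σ (b_m/m) yᵐ` at a `p`-nilpotent `y` of index `N`. [cite: Colmez1992PeriodesAbeliennes, §2] -/
def coeffD (N m : ℕ) : ℤ_[p] :=
  if h : m ≠ 0 ∧ m.factorization p ≤ N + m / N then Classical.choose (exists_natCast_mul_eq_pow h.1 h.2) else 0

/-- `coeffD N 0 = 0`. [cite: Colmez1992PeriodesAbeliennes, §2] -/
@[simp] theorem coeffD_zero (N : ℕ) : coeffD p N 0 = 0 := by
  rw [coeffD, dif_neg]; simp

/-- **`m · d_{N,m} = p^{N + m/N}`.** [cite: Colmez1992PeriodesAbeliennes, §2] -/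
theorem natCast_mul_coeffD {N m : ℕ} (hN : 1 ≤ N) (hm : m ≠ 0) :
    (m : ℤ_[p]) * coeffD p N m = (p : ℤ_[p]) ^ (N + m / N) := by
  have h : m ≠ 0 ∧ m.factorization p ≤ N + m / N := ⟨hm, (factorization_lt_add_div (p := p) hN hm).le⟩
  rw [coeffD, dif_pos h]
  exact Classical.choose_spec (exists_natCast_mul_eq_pow h.1 h.2)

/-- **Decay: `d_{N,m} ∈ pⁿℤ_p` for `m/N ≥ 2n`.** [cite: Colmez1992PeriodesAbeliennes, §2] -/
theorem exists_coeffD_eq_pow_mul {N m n : ℕ} (hN : 1 ≤ N) (hm : m ≠ 0) (hn : 2 * n ≤ m / N) :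
    ∃ d : ℤ_[p], coeffD p N m = (p : ℤ_[p]) ^ n * d := by
  have hv : m.factorization p ≤ N + m / N - n := by
    have := factorization_add_lt_add_div (p := p) hN hm hn; omega
  obtain ⟨d, hd⟩ := exists_natCast_mul_eq_pow (p := p) hm hv
  refine ⟨d, mul_left_cancel₀ (Nat.cast_ne_zero.2 hm : (m : ℤ_[p]) ≠ 0) ?_⟩
  rw [natCast_mul_coeffD hN hm, mul_left_comm, hd, ← pow_add]
  congr 1
  have := factorization_add_lt_add_div (p := p) hN hm hn
  omega

/-! ## §2 The terms `p^N (b_m/m) yᵐ = ι(b_m d_{N,m}) z^{m/N} y^{m%N}` and the partial sums -/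

universe u

variable {B : Type u} [CommRing B] (ι : ℤ_[p] →+* B) (b : ℕ → ℤ_[p]) (N : ℕ) (y z : B)

/-- **The `m`-th term `T_m = ι(b_m · d_{N,m}) · z^{m/N} · y^{m % N} ∈ B`** of `p^N · Σ (b_m/m) yᵐ` at a `p`-nilpotent `y`
with witness `z` (`y^N = p z`); `T_0 = 0`. [cite: Colmez1992PeriodesAbeliennes, §2] -/
def term (m : ℕ) : B := ι (b m * coeffD p N m) * z ^ (m / N) * y ^ (m % N)

/-- `T_0 = 0`. [cite: Colmez1992PeriodesAbeliennes, §2] -/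
@[simp] theorem term_zero : term ι b N y z 0 = 0 := by
  simp [term]

/-- ★ **`m · T_m = ι(b_m) · p^N · yᵐ`** when `y^N = p·z` (`N, m ≥ 1`): the terms ARE the terms of `p^N Σ (b_m/m) yᵐ`.
[cite: Colmez1992PeriodesAbeliennes, §2] -/
theorem natCast_mul_term {N : ℕ} (hN : 1 ≤ N) {y z : B} (hyz : y ^ N = (p : B) * z) {m : ℕ} (hm : m ≠ 0) :
    (m : B) * term ι b N y z m = ι (b m) * (p : B) ^ N * y ^ m := by
  have key : (m : B) * ι (b m * coeffD p N m) = ι (b m) * (p : B) ^ (N + m / N) := by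
    rw [map_mul, mul_left_comm, ← map_natCast ι m, ← map_mul, natCast_mul_coeffD hN hm, map_pow, map_natCast]
  have hy : y ^ m = (y ^ N) ^ (m / N) * y ^ (m % N) := by
    rw [← pow_mul, ← pow_add, Nat.div_add_mod m N]
  calc (m : B) * term ι b N y z m
      = ((m : B) * ι (b m * coeffD p N m)) * z ^ (m / N) * y ^ (m % N) := by rw [term]; ring
    _ = ι (b m) * (p : B) ^ N * ((p : B) * z) ^ (m / N) * y ^ (m % N) := by rw [key, pow_add, mul_pow]; ring
    _ = ι (b m) * (p : B) ^ N * y ^ m := by rw [← hyz, hy]; ring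

/-- **Decay of the terms: `T_m ∈ pⁿ B` for `m/N ≥ 2n`** (no hypothesis on `y`, `z`). [cite: Colmez1992PeriodesAbeliennes, §2] -/
theorem exists_term_eq_pow_mul {N : ℕ} (hN : 1 ≤ N) {m n : ℕ} (hm : m ≠ 0) (hn : 2 * n ≤ m / N) :
    ∃ w : B, term ι b N y z m = (p : B) ^ n * w := by
  obtain ⟨d, hd⟩ := exists_coeffD_eq_pow_mul (p := p) hN hm hn
  refine ⟨ι (b m * d) * z ^ (m / N) * y ^ (m % N), ?_⟩
  rw [term, hd, mul_left_comm (b m), map_mul, map_pow, map_natCast]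
  ring

/-- `T_m ∈ (p)ⁿ` for `m/N ≥ 2n`. [cite: Colmez1992PeriodesAbeliennes, §2] -/
theorem term_mem_span_pow {N : ℕ} (hN : 1 ≤ N) {m n : ℕ} (hm : m ≠ 0) (hn : 2 * n ≤ m / N) :
    term ι b N y z m ∈ Ideal.span {(p : B)} ^ n := by
  obtain ⟨w, hw⟩ := exists_term_eq_pow_mul ι b y z hN hm hn
  rw [hw, Ideal.span_singleton_pow]
  exact Ideal.mul_mem_right _ _ (Ideal.mem_span_singleton_self _)

/-- **The partial sum `S_M = Σ_{m=1}^{M} T_m`.** [cite: Colmez1992PeriodesAbeliennes, §2] -/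
def partialSum (M : ℕ) : B := ∑ m ∈ range M, term ι b N y z (m + 1)

/-- `S_0 = 0`. [cite: Colmez1992PeriodesAbeliennes, §2] -/
@[simp] theorem partialSum_zero : partialSum ι b N y z 0 = 0 := by simp [partialSum]

/-- `S_{M+1} = S_M + T_{M+1}`. [cite: Colmez1992PeriodesAbeliennes, §2] -/
theorem partialSum_succ (M : ℕ) : partialSum ι b N y z (M + 1) = partialSum ι b N y z M + term ι b N y z (M + 1) := by
  rw [partialSum, partialSum, sum_range_succ]

/-- **Tail estimate: `S_{M'} − S_M ∈ pⁿB` for `2nN ≤ M ≤ M'`.** [cite: Colmez1992PeriodesAbeliennes, §2] -/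
theorem partialSum_sub_partialSum_mem {N : ℕ} (hN : 1 ≤ N) {M M' n : ℕ} (hM : 2 * n * N ≤ M) (hMM' : M ≤ M') :
    partialSum ι b N y z M' - partialSum ι b N y z M ∈ Ideal.span {(p : B)} ^ n := by
  have h : partialSum ι b N y z M' - partialSum ι b N y z M = ∑ m ∈ Ico M M', term ι b N y z (m + 1) := by
    simp only [partialSum, range_eq_Ico]
    rw [← sum_Ico_consecutive _ (Nat.zero_le M) hMM', add_sub_cancel_left]
  rw [h]
  refine Ideal.sum_mem _ fun m hmI => term_mem_span_pow ι b y z hN (Nat.succ_ne_zero m) ?_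
  have hMm : M ≤ m := (mem_Ico.1 hmI).1
  exact (Nat.le_div_iff_mul_le hN).2 (by nlinarith)

/-- **The partial sums `n ↦ S_{2nN}` form a `p`-adic Cauchy sequence.** [cite: Colmez1992PeriodesAbeliennes, §2] -/
theorem isAdicCauchy_partialSum {N : ℕ} (hN : 1 ≤ N) :
    AdicCompletion.IsAdicCauchy (Ideal.span {(p : B)}) B fun n => partialSum ι b N y z (2 * n * N) := by
  intro m n hmn
  rw [SModEq.sub_mem, smul_eq_mul, Ideal.mul_top, ← neg_sub]
  exact neg_mem (partialSum_sub_partialSum_mem ι b y z hN le_rfl (by nlinarith))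

/-! ## §3 The value `p^N · ℓ_b(y) ∈ B^_(p)` in the `p`-adic completion -/

/-- ★ **`logSum ι b N y z ∈ B^_(p)`**: the `p`-adic sum `p^N · Σ_{m≥1} (b_m/m) yᵐ` at a `p`-nilpotent `y` with `y^N = p z`,
as the class of the Cauchy sequence `n ↦ S_{2nN}` in Mathlib's `AdicCompletion (p) B` (junk `0` for `N = 0`).
[cite: Colmez1992PeriodesAbeliennes, §2] -/
def logSum : AdicCompletion (Ideal.span {(p : B)}) B :=
  if hN : 1 ≤ N then
    AdicCompletion.mk (Ideal.span {(p : B)}) B ⟨fun n => partialSum ι b N y z (2 * n * N), isAdicCauchy_partialSum ι b y z hN⟩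
  else 0

/-- **`logSum mod pⁿ = S_{2nN} mod pⁿ`.** [cite: Colmez1992PeriodesAbeliennes, §2] -/
theorem evalₐ_logSum {N : ℕ} (hN : 1 ≤ N) (n : ℕ) :
    AdicCompletion.evalₐ (Ideal.span {(p : B)}) n (logSum ι b N y z) =
      Ideal.Quotient.mk _ (partialSum ι b N y z (2 * n * N)) := by
  rw [logSum, dif_pos hN]
  exact AdicCompletion.evalₐ_mk _ _ _

/-- **Any truncation point `M ≥ 2nN` represents `logSum` modulo `pⁿ`.** [cite: Colmez1992PeriodesAbeliennes, §2] -/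
theorem evalₐ_logSum_of_le {N : ℕ} (hN : 1 ≤ N) {n M : ℕ} (hM : 2 * n * N ≤ M) :
    AdicCompletion.evalₐ (Ideal.span {(p : B)}) n (logSum ι b N y z) =
      Ideal.Quotient.mk _ (partialSum ι b N y z M) := by
  rw [evalₐ_logSum ι b y z hN, Ideal.Quotient.mk_eq_mk_iff_sub_mem, ← neg_sub]
  exact neg_mem (partialSum_sub_partialSum_mem ι b y z hN le_rfl hM)

/-- `logSum` at `N = 0` is the junk value `0`. [cite: Colmez1992PeriodesAbeliennes, §2] -/
theorem logSum_of_eq_zero : logSum ι b 0 y z = 0 := by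
  rw [logSum, dif_neg (by omega)]

/-! ## §4 Linearity in the numerators and naturality along ring maps -/

/-- `T_m(b + b') = T_m(b) + T_m(b')`. [cite: Hazewinkel1978, Ch. I §2.1] -/
theorem term_add (b' : ℕ → ℤ_[p]) (m : ℕ) :
    term ι (b + b') N y z m = term ι b N y z m + term ι b' N y z m := by
  simp only [term, Pi.add_apply, add_mul, map_add, map_mul]

/-- `T_m(c·b) = ι(c)·T_m(b)`. [cite: Hazewinkel1978, Ch. I §2.1] -/
theorem term_mul_left (c : ℤ_[p]) (m : ℕ) :
    term ι (fun k => c * b k) N y z m = ι c * term ι b N y z m := by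
  simp only [term, mul_assoc, map_mul]

/-- `S_M(b + b') = S_M(b) + S_M(b')`. [cite: Hazewinkel1978, Ch. I §2.1] -/
theorem partialSum_add (b' : ℕ → ℤ_[p]) (M : ℕ) :
    partialSum ι (b + b') N y z M = partialSum ι b N y z M + partialSum ι b' N y z M := by
  simp only [partialSum, term_add, sum_add_distrib]

/-- `S_M(c·b) = ι(c)·S_M(b)`. [cite: Hazewinkel1978, Ch. I §2.1] -/
theorem partialSum_mul_left (c : ℤ_[p]) (M : ℕ) :
    partialSum ι (fun k => c * b k) N y z M = ι c * partialSum ι b N y z M := by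
  simp only [partialSum, term_mul_left, mul_sum]

/-- **Additivity in the numerators: `logSum(b + b') = logSum(b) + logSum(b')`.** [cite: Hazewinkel1978, Ch. I §2.1] -/
theorem logSum_add (b' : ℕ → ℤ_[p]) :
    logSum ι (b + b') N y z = logSum ι b N y z + logSum ι b' N y z := by
  by_cases hN : 1 ≤ N
  · refine AdicCompletion.ext_evalₐ fun n => ?_
    rw [map_add, evalₐ_logSum ι _ y z hN, evalₐ_logSum ι _ y z hN, evalₐ_logSum ι _ y z hN, partialSum_add, map_add]
  · have h0 : N = 0 := by omega
    subst h0; simp [logSum_of_eq_zero]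

/-- **Homogeneity in the numerators: `logSum(c·b) = ι(c)·logSum(b)`.** [cite: Hazewinkel1978, Ch. I §2.1] -/
theorem logSum_mul_left (c : ℤ_[p]) :
    logSum ι (fun k => c * b k) N y z = AdicCompletion.of (Ideal.span {(p : B)}) B (ι c) * logSum ι b N y z := by
  by_cases hN : 1 ≤ N
  · refine AdicCompletion.ext_evalₐ fun n => ?_
    rw [map_mul, evalₐ_logSum ι _ y z hN, evalₐ_logSum ι _ y z hN, partialSum_mul_left, map_mul,
      AdicCompletion.evalₐ_of]
  · have h0 : N = 0 := by omega
    subst h0; simp [logSum_of_eq_zero]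

section Naturality

variable {B' : Type u} [CommRing B'] (g : B →+* B')

omit hp in
/-- A ring map sends `(p)` into `(p)`. [cite: BergerLaurent2002, §1.2] -/
theorem map_span_natCast_le : (Ideal.span {(p : B)}).map g ≤ Ideal.span {(p : B')} := by
  rw [Ideal.map_span, Set.image_singleton, map_natCast]

/-- `g(T_m(ι, y, z)) = T_m(g∘ι, g y, g z)`. [cite: BergerLaurent2002, §1.2] -/
theorem map_term (m : ℕ) : g (term ι b N y z m) = term (g.comp ι) b N (g y) (g z) m := by
  simp only [term, map_mul, map_pow, RingHom.comp_apply]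

/-- `g(S_M) = S_M` along `g`. [cite: BergerLaurent2002, §1.2] -/
theorem map_partialSum (M : ℕ) : g (partialSum ι b N y z M) = partialSum (g.comp ι) b N (g y) (g z) M := by
  simp only [partialSum, map_sum, map_term]

/-- ★ **Naturality: `B^(g) (logSum ι b N y z) = logSum (g∘ι) b N (g y) (g z)`** for every ring map `g : B → B'`
(tree `adicCompletionMap`). In particular a ring ENDOMORPHISM of `B` fixing `ι(ℤ_p)` — a Frobenius — acts on these
`p`-adic sums through its arguments. [cite: BergerLaurent2002, §1.2] -/
theorem adicCompletionMap_logSum :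
    Literature.AlgebraicGeometry.Resolution.adicCompletionMap (Ideal.span {(p : B)}) (Ideal.span {(p : B')}) g
        (map_span_natCast_le g) (logSum ι b N y z) =
      logSum (g.comp ι) b N (g y) (g z) := by
  by_cases hN : 1 ≤ N
  · refine AdicCompletion.ext_evalₐ fun n => ?_
    rw [Literature.AlgebraicGeometry.Resolution.evalₐ_adicCompletionMap, evalₐ_logSum ι b y z hN,
      evalₐ_logSum _ b _ _ hN, Ideal.quotientMap_mk, map_partialSum]
  · have h0 : N = 0 := by omega
    subst h0; simp [logSum_of_eq_zero]

end Naturality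

/-! ## §5 Independence of the witness `z` and of the exponent `N` (domains of characteristic zero) -/

/-- The witness is unique when `p` is a non-zero-divisor: `y^N = p z = p z' ⇒ z = z'`. [cite: Colmez1992PeriodesAbeliennes, §2] -/
theorem witness_unique [IsDomain B] [CharZero B] {N : ℕ} {y z z' : B} (hyz : y ^ N = (p : B) * z)
    (hyz' : y ^ N = (p : B) * z') : z = z' :=
  mul_left_cancel₀ (Nat.cast_ne_zero.2 hp.out.ne_zero : (p : B) ≠ 0) (hyz.symm.trans hyz')

/-- **Change of exponent at the level of terms**: for `N ≤ N'`, `y^N = p z`, `y^{N'} = p z'`: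
`T^{N'}_m = p^{N'−N} · T^{N}_m` (both are `ι(b_m) p^{N'} yᵐ / m`; `B` a domain of characteristic `0`).
[cite: Colmez1992PeriodesAbeliennes, §2] -/
theorem term_eq_pow_mul_term [IsDomain B] [CharZero B] {N N' : ℕ} (hN : 1 ≤ N) (hNN' : N ≤ N') {y z z' : B}
    (hyz : y ^ N = (p : B) * z) (hyz' : y ^ N' = (p : B) * z') (m : ℕ) :
    term ι b N' y z' m = (p : B) ^ (N' - N) * term ι b N y z m := by
  rcases eq_or_ne m 0 with rfl | hm
  · simp
  have hN' : 1 ≤ N' := hN.trans hNN'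
  refine mul_left_cancel₀ (Nat.cast_ne_zero.2 hm : (m : B) ≠ 0) ?_
  rw [natCast_mul_term ι b hN' hyz' hm, mul_left_comm, natCast_mul_term ι b hN hyz hm]
  rw [show (p : B) ^ N' = (p : B) ^ (N' - N) * (p : B) ^ N by rw [← pow_add, Nat.sub_add_cancel hNN']]
  ring

/-- **Change of exponent: `logSum N' = p^{N'−N} · logSum N`** for `1 ≤ N ≤ N'` (`B` a domain of characteristic `0`).
[cite: Colmez1992PeriodesAbeliennes, §2] -/
theorem logSum_eq_pow_mul_logSum [IsDomain B] [CharZero B] {N N' : ℕ} (hN : 1 ≤ N) (hNN' : N ≤ N') {y z z' : B}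
    (hyz : y ^ N = (p : B) * z) (hyz' : y ^ N' = (p : B) * z') :
    logSum ι b N' y z' =
      AdicCompletion.of (Ideal.span {(p : B)}) B ((p : B) ^ (N' - N)) * logSum ι b N y z := by
  have hN' : 1 ≤ N' := hN.trans hNN'
  refine AdicCompletion.ext_evalₐ fun n => ?_
  have hM : 2 * n * N ≤ 2 * n * N' := Nat.mul_le_mul_left _ hNN'
  rw [evalₐ_logSum ι b y z' hN', map_mul, AdicCompletion.evalₐ_of, evalₐ_logSum_of_le ι b y z hN hM, ← map_mul]
  congr 1
  simp only [partialSum, mul_sum, term_eq_pow_mul_term ι b hN hNN' hyz hyz']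

/-- **Independence of the witness**: `logSum ι b N y z = logSum ι b N y z'` whenever both `z, z'` witness `y^N = p·z`
(`B` a domain of characteristic `0`). [cite: Colmez1992PeriodesAbeliennes, §2] -/
theorem logSum_congr_witness [IsDomain B] [CharZero B] {N : ℕ} {y z z' : B} (hyz : y ^ N = (p : B) * z)
    (hyz' : y ^ N = (p : B) * z') : logSum ι b N y z = logSum ι b N y z' := by
  rw [witness_unique (p := p) hyz hyz']

end PadicLogSeries

end Literature.RingTheory.FormalGroups

end
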